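import Summits.BirchSwinnertonDyer.BirchSwinnertonDyer.Theorems.PrintCFramBottomClassIndexLawFiveLeKummerClassRadical
import HarnessLib

/-!
# Route `PrintCFram`, crux C2 `BottomClassIndexLawFiveLe` (stmt-BirchSwinnertonDyer-20372), line
# `eisenstein-resource-bdp-line` (registry v22; B1-sha first-order census, CASE R): **THE CLASS RADICALS OF A FAMILY OF
# EIGENCLASSES ARE JOINTLY INDEPENDENT MODULO `E_K · K^{×p}`** — the `p`-RANK form of w7 g4's class radical
# (`KummerRadical.exists_eigenRadical_of_eigenclass`, p683707): the radical `α` of an `e`-eigenclass `x` comes WITH its ideal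
# `p`-th root `𝔟` (`(α) = 𝔟^p`, `[𝔟] = x^{[K:ℚ]}`), and for `𝔽_p`-independent eigenclasses `x_i` a relation
# `∏ α_i^{n_i} ∈ E_K · K^{×p}` forces `p ∣ n_i` for every `i`
# (cell `bsd-print-cfram`, width seat `bsd-line-cfram-p1-w7` g5; helper `--supports` 20372; 0 defs, 0 facts, 0 sorry)

HONEST FRAMING. Nothing about BSD is proved here; no summit statement is proved by this seat; no stub of the registered
skeleton is closed. This is the ideal-arithmetic input of the p-RANK LOWER BOUND of the B1-sha census (HOME/HANDOFF §w4 g10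
FINAL, successor item (b)): «`r` independent even eigenclasses in `Cl(K)[p]` ⟹ `r + 1` independent admissible Kummer characters
⟹ `p^{r+1} ≤ #R_rel(ψ-line)` ⟹ (LA) `p^{r+1} ≤ #Sel_p(W/ℚ)`», the lower twin of w4 g10's
`SelmerCount.natCard_selmerGroup_le_sq_mul_sq_of_evenChiTorsion_le` (p685197, `#Sel_p ≤ p²·t²`). w7 g4's single-class statement
(iii) `α ∉ E_K K^{×p}` is the case `r = 1`; for a family the classes `[𝔟_i] = x_i^{[K:ℚ]}` must be visible, so §1 re-runs the
construction `α = ∏_τ τ(α₀)^{e(τ⁻¹)}`, `(α₀) = 𝔞^p`, `x = [𝔞]`, exposing `𝔟 = ∏_τ τ(𝔞)^{e(τ⁻¹)}`.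

* §1 **`exists_eigenRadical_of_eigenclass_with_ideal`** — `K/ℚ` Galois, `θ : Gal(K/ℚ) →* ℤ_pˣ` with shadow `e`, `x` an
  `e`-eigenclass with `x^p = 1` ⊢ `∃ α ≠ 0, 𝔟`: exact eigen-relations `σα = α^{e σ} y^p`, a `v`-unit representative `αγ^p ∈ 𝓞_K ∖ v`
  at every place, `(α) = 𝔟^p`, `[𝔟] = x^{[K:ℚ]}` (no `x ≠ 1` needed).
* §2 **`forall_dvd_of_prod_pow_eq_unit_mul_pow`** — `p ∤ [K:ℚ]`; `(α_i) = 𝔟_i^p`, `[𝔟_i] = x_i^{[K:ℚ]}`, the `x_i` independent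
  (`∏ x_i^{n_i} = 1 ⟹ ∀ i, p ∣ n_i`); then `∏ α_i^{n_i} = u · y^p` (`u ∈ E_K`, `y ∈ K`) ⟹ `∀ i, p ∣ n_i`. Proof: write `y = n/d`;
  `(∏ 𝔟_i^{n_i} · (d))^p = (n)^p`, so `∏ 𝔟_i^{n_i} · (d) = (n)` (`ideal_pow_left_injective`), hence `∏ x_i^{[K:ℚ] n_i} = 1`.

THEOREMS ONLY; no definition, no named fact, no `sorry`. References: [Washington1997] §10.2 (proof of Thm. 10.9: the radicals
attached to `A[p]`); [Lang1990] Ch. 13 §2 Thm. 2.1 (proof); [Gras2003] Ch. II §5.4 (reflection in `p`-ranks).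
-/

set_option autoImplicit false
-- `…BirchSwinnertonDyer.BirchSwinnertonDyer.Theorems…` is the problem's mandated namespace (D-0017).
set_option linter.dupNamespace false

noncomputable section

namespace Summit.BirchSwinnertonDyer.BirchSwinnertonDyer.Theorems.PrintCFram.KummerRadical

open Literature.NumberTheory.NumberFields Literature.NumberTheory.GaloisRepresentations
open NumberField IsDedekindDomain Field
open scoped nonZeroDivisors Pointwise

/-! ## §1 The class radical together with its ideal `p`-th root -/

section ClassRadical

variable {K : Type} [Field K] [NumberField K] [IsGalois ℚ K] {p : ℕ} [hp : Fact p.Prime]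

omit [IsGalois ℚ K] in
/-- `‖θ σ − e σ‖ < 1` read through `PadicInt.toZMod`. [folklore] -/
private theorem toZMod_eq_of_norm_lt' (θ : (K ≃ₐ[ℚ] K) →* ℤ_[p]ˣ) (e : (K ≃ₐ[ℚ] K) → ℕ)
    (hθe : ∀ σ, ‖((θ σ : ℤ_[p]ˣ) : ℤ_[p]) - (e σ : ℤ_[p])‖ < 1) (σ : K ≃ₐ[ℚ] K) :
    PadicInt.toZMod ((θ σ : ℤ_[p]ˣ) : ℤ_[p]) = (e σ : ZMod p) := by
  have hmem : ((θ σ : ℤ_[p]ˣ) : ℤ_[p]) - (e σ : ℤ_[p]) ∈ RingHom.ker (PadicInt.toZMod (p := p)) := by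
    rw [PadicInt.ker_toZMod]; exact PadicInt.mem_nonunits.2 (hθe σ)
  rw [RingHom.mem_ker, map_sub, map_natCast, sub_eq_zero] at hmem
  exact hmem

omit [IsGalois ℚ K] in
/-- `e(a b) = e(a) e(b) + p k` in `ℤ`. [folklore] -/
private theorem exists_int_of_mul' (θ : (K ≃ₐ[ℚ] K) →* ℤ_[p]ˣ) (e : (K ≃ₐ[ℚ] K) → ℕ)
    (hθe : ∀ σ, ‖((θ σ : ℤ_[p]ˣ) : ℤ_[p]) - (e σ : ℤ_[p])‖ < 1) (a b : K ≃ₐ[ℚ] K) :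
    ∃ k : ℤ, (e (a * b) : ℤ) = (e a : ℤ) * (e b : ℤ) + (p : ℤ) * k := by
  have h1 := toZMod_eq_of_norm_lt' θ e hθe (a * b)
  have h2 : PadicInt.toZMod ((θ (a * b) : ℤ_[p]ˣ) : ℤ_[p]) = (e a : ZMod p) * (e b : ZMod p) := by
    rw [map_mul, Units.val_mul, map_mul, toZMod_eq_of_norm_lt' θ e hθe a, toZMod_eq_of_norm_lt' θ e hθe b]
  have h3 : ((e (a * b) : ℤ) : ZMod p) = (((e a : ℤ) * (e b : ℤ) : ℤ) : ZMod p) := by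
    push_cast; rw [← h1, h2]
  rw [ZMod.intCast_eq_intCast_iff, Int.modEq_iff_dvd] at h3
  obtain ⟨k, hk⟩ := h3
  exact ⟨-k, by linarith⟩

omit [IsGalois ℚ K] in
/-- The coercion of `intAut τ y` to `K` is `τ y`. [folklore] -/
private theorem coe_intAut' (τ : K ≃ₐ[ℚ] K) (y : 𝓞 K) : ((AmbiguousClass.intAut τ y : 𝓞 K) : K) = τ (y : K) := rfl

/-- **THE CLASS RADICAL WITH ITS IDEAL `p`-TH ROOT.** `K/ℚ` Galois, `θ : Gal(K/ℚ) →* ℤ_pˣ` with `θ ≡ e (mod p)`; `x ∈ Cl(𝓞 K)`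
an `e`-EIGENCLASS with `x^p = 1` (`σ·x = e σ • x`). Then there are `α ∈ 𝓞 K`, `α ≠ 0`, and a nonzero ideal `𝔟` with
(i) EXACT eigen-relations `σ α = α^{e σ} · y_σ^p` (`y_σ ∈ K`) for every `σ ∈ Gal(K/ℚ)`;
(ii) for every place `v` a representative `α γ^p = a ∈ 𝓞 K ∖ v`;
(iii) `(α) = 𝔟^p`; (iv) `[𝔟] = x^{[K:ℚ]}`.
CONSTRUCTION (as in `exists_eigenRadical_of_eigenclass`): `x = [𝔞]`, `𝔞^p = (α₀)`, `α = ∏_τ τ(α₀)^{e(τ⁻¹)}`,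
`𝔟 = ∏_τ τ(𝔞)^{e(τ⁻¹)}`, `[𝔟] = x^{Σ_τ e(τ)e(τ⁻¹)} = x^{|G|}`.
[cite: Washington1997, §10.2 (proof of Thm. 10.9)] [cite: Lang1990, Ch. 13 §2 Thm. 2.1 (proof)] -/
theorem exists_eigenRadical_of_eigenclass_with_ideal
    (θ : (K ≃ₐ[ℚ] K) →* ℤ_[p]ˣ) (e : (K ≃ₐ[ℚ] K) → ℕ)
    (hθe : ∀ σ, ‖((θ σ : ℤ_[p]ˣ) : ℤ_[p]) - (e σ : ℤ_[p])‖ < 1)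
    (x : ClassGroup (𝓞 K)) (hxp : x ^ p = 1)
    (hxe : ∀ σ : K ≃ₐ[ℚ] K, classGroupRep ℚ K σ (Additive.ofMul x) = e σ • Additive.ofMul x) :
    ∃ (α : 𝓞 K) (𝔟 : (Ideal (𝓞 K))⁰), α ≠ 0 ∧
      (∀ σ : K ≃ₐ[ℚ] K, ∃ y : K, σ (α : K) = (α : K) ^ e σ * y ^ p) ∧
      (∀ v : HeightOneSpectrum (𝓞 K), ∃ (γ : K) (a : 𝓞 K), a ∉ v.asIdeal ∧ (α : K) * γ ^ p = (a : K)) ∧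
      Ideal.span {α} = (𝔟 : Ideal (𝓞 K)) ^ p ∧
      ClassGroup.mk0 𝔟 = x ^ Module.finrank ℚ K := by
  classical
  have hpr : p.Prime := hp.out
  -- Step A: `x = [𝔞]`, `𝔞^p = (α₀)`
  obtain ⟨𝔞, h𝔞x⟩ := ClassGroup.mk0_surjective x
  have h𝔞0 : (𝔞 : Ideal (𝓞 K)) ≠ ⊥ := nonZeroDivisors.ne_zero 𝔞.2
  have hpow_mem : (𝔞 : Ideal (𝓞 K)) ^ p ∈ (Ideal (𝓞 K))⁰ := pow_mem 𝔞.2 p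
  have hprinc : ((𝔞 : Ideal (𝓞 K)) ^ p).IsPrincipal := by
    rw [← ClassGroup.mk0_eq_one_iff hpow_mem]
    have h : (⟨(𝔞 : Ideal (𝓞 K)) ^ p, hpow_mem⟩ : (Ideal (𝓞 K))⁰) = 𝔞 ^ p := Subtype.ext rfl
    rw [h, map_pow, h𝔞x, hxp]
  obtain ⟨α₀, hα₀⟩ := hprinc.principal
  have hα₀' : (𝔞 : Ideal (𝓞 K)) ^ p = Ideal.span {α₀} := hα₀
  have hα₀0 : α₀ ≠ 0 := by
    intro h
    rw [h, Ideal.span_singleton_eq_bot.mpr rfl] at hα₀'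
    exact pow_ne_zero _ h𝔞0 hα₀'
  have hα₀K : (α₀ : K) ≠ 0 := RingOfIntegers.coe_ne_zero_iff.mpr hα₀0
  -- Step B: the projector `α = ∏_τ τ(α₀)^{e(τ⁻¹)}` and its ideal `p`-th root `𝔟 = ∏_τ τ(𝔞)^{e(τ⁻¹)}`
  set α : 𝓞 K := ∏ τ : K ≃ₐ[ℚ] K, AmbiguousClass.intAut τ α₀ ^ e τ⁻¹ with hαdef
  have hαK : (α : K) = ∏ τ : K ≃ₐ[ℚ] K, τ (α₀ : K) ^ e τ⁻¹ := by
    rw [hαdef]; push_cast; simp only [coe_intAut']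
  have hα0 : α ≠ 0 := by
    rw [hαdef]
    exact Finset.prod_ne_zero_iff.mpr fun τ _ => pow_ne_zero _ fun h =>
      hα₀0 ((map_eq_zero_iff _ (AmbiguousClass.intAut τ).injective).mp h)
  set 𝔟 : Ideal (𝓞 K) := ∏ τ : K ≃ₐ[ℚ] K, ((𝔞 : Ideal (𝓞 K)).map (AmbiguousClass.intAut τ : 𝓞 K →+* 𝓞 K)) ^ e τ⁻¹
    with h𝔟def
  have hspan : Ideal.span {α} = 𝔟 ^ p := by
    rw [hαdef, h𝔟def, ← Ideal.prod_span_singleton, ← Finset.prod_pow]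
    refine Finset.prod_congr rfl fun τ _ => ?_
    rw [← Ideal.span_singleton_pow,
      show Ideal.span {AmbiguousClass.intAut τ α₀} =
        ((𝔞 : Ideal (𝓞 K)) ^ p).map (AmbiguousClass.intAut τ : 𝓞 K →+* 𝓞 K) by
          rw [hα₀', Ideal.map_span, Set.image_singleton]; rfl,
      Ideal.map_pow, ← pow_mul, ← pow_mul, mul_comm]
  have hmem𝔟 : 𝔟 ∈ (Ideal (𝓞 K))⁰ := by
    rw [h𝔟def]
    exact prod_mem fun τ _ => pow_mem (AmbiguousClass.map_mem_nonZeroDivisors τ 𝔞) _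
  have h𝔟0 : 𝔟 ≠ ⊥ := nonZeroDivisors.ne_zero hmem𝔟
  -- `mk0 𝔟 = x^{Σ e τ e τ⁻¹} = x^{|G|}`
  have hclass : ClassGroup.mk0 ⟨𝔟, hmem𝔟⟩ = x ^ ∑ τ : K ≃ₐ[ℚ] K, e τ * e τ⁻¹ := by
    have h1 : (⟨𝔟, hmem𝔟⟩ : (Ideal (𝓞 K))⁰) =
        ∏ τ : K ≃ₐ[ℚ] K, (⟨_, AmbiguousClass.map_mem_nonZeroDivisors τ 𝔞⟩ : (Ideal (𝓞 K))⁰) ^ e τ⁻¹ := by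
      apply Subtype.ext
      change 𝔟 = _
      rw [h𝔟def, Submonoid.coe_finsetProd]
      refine Finset.prod_congr rfl fun τ _ => ?_
      rw [SubmonoidClass.coe_pow]
    rw [h1, map_prod]
    have hfac : ∀ τ : K ≃ₐ[ℚ] K,
        ClassGroup.mk0 ((⟨_, AmbiguousClass.map_mem_nonZeroDivisors τ 𝔞⟩ : (Ideal (𝓞 K))⁰) ^ e τ⁻¹) =
          x ^ (e τ * e τ⁻¹) := by
      intro τ
      rw [map_pow, ← AmbiguousClass.mulEquiv_mk0 τ 𝔞, h𝔞x]
      have h2 := hxe τ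
      rw [classGroupRep_apply] at h2
      have h3 : ClassGroup.mulEquiv (AmbiguousClass.intAut τ) x = x ^ e τ := by
        have h4 := congrArg Additive.toMul h2
        rwa [toMul_ofMul, toMul_nsmul, toMul_ofMul] at h4
      rw [h3, ← pow_mul]
    simp_rw [hfac]
    exact Finset.prod_pow_eq_pow_sum _ _ _
  have hsum : x ^ (∑ τ : K ≃ₐ[ℚ] K, e τ * e τ⁻¹) = x ^ Module.finrank ℚ K := by
    rw [← IsGalois.card_aut_eq_finrank, Nat.card_eq_fintype_card, pow_eq_pow_mod _ hxp,
      pow_eq_pow_mod (Fintype.card (K ≃ₐ[ℚ] K)) hxp]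
    congr 1
    have h1 : ∀ τ : K ≃ₐ[ℚ] K, ((e τ * e τ⁻¹ : ℕ) : ZMod p) = 1 := by
      intro τ
      rw [Nat.cast_mul, ← toZMod_eq_of_norm_lt' θ e hθe τ, ← toZMod_eq_of_norm_lt' θ e hθe τ⁻¹, ← map_mul,
        ← Units.val_mul, ← map_mul, mul_inv_cancel, map_one, Units.val_one, map_one]
    have h2 : ((∑ τ : K ≃ₐ[ℚ] K, e τ * e τ⁻¹ : ℕ) : ZMod p) = (Fintype.card (K ≃ₐ[ℚ] K) : ZMod p) := by
      rw [Nat.cast_sum]; simp_rw [h1]; rw [Finset.sum_const, Finset.card_univ, nsmul_eq_mul, mul_one]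
    exact (ZMod.natCast_eq_natCast_iff' _ _ _).1 h2
  refine ⟨α, ⟨𝔟, hmem𝔟⟩, hα0, fun σ => ?_, fun v => ?_, hspan, hclass.trans hsum⟩
  · -- (i) exact eigen-relations
    have hk : ∀ ρ' : K ≃ₐ[ℚ] K, ∃ k : ℤ, (e (ρ'⁻¹ * σ) : ℤ) = (e ρ'⁻¹ : ℤ) * (e σ : ℤ) + (p : ℤ) * k :=
      fun ρ' => exists_int_of_mul' θ e hθe ρ'⁻¹ σ
    choose k hk using hk
    refine ⟨∏ ρ' : K ≃ₐ[ℚ] K, ρ' (α₀ : K) ^ k ρ', ?_⟩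
    have hne : ∀ ρ' : K ≃ₐ[ℚ] K, ρ' (α₀ : K) ≠ 0 := fun ρ' => (map_ne_zero_iff _ ρ'.injective).mpr hα₀K
    have hstep : σ (α : K) = ∏ ρ' : K ≃ₐ[ℚ] K, ρ' (α₀ : K) ^ e (ρ'⁻¹ * σ) := by
      rw [hαK, map_prod]
      simp_rw [map_pow, ← AlgEquiv.mul_apply]
      exact Fintype.prod_equiv (Equiv.mulLeft σ) _ _ (fun τ => by
        simp only [Equiv.coe_mulLeft, mul_inv_rev, inv_mul_cancel_right])
    rw [hstep, hαK, ← Finset.prod_pow, ← Finset.prod_pow, ← Finset.prod_mul_distrib]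
    refine Finset.prod_congr rfl fun ρ' _ => ?_
    rw [← zpow_natCast, ← zpow_natCast (ρ' (α₀ : K) ^ e ρ'⁻¹), ← zpow_natCast (ρ' (α₀ : K) ^ k ρ'),
      ← zpow_natCast (ρ' (α₀ : K)), ← zpow_mul, ← zpow_mul, ← zpow_add₀ (hne ρ'), hk ρ', mul_comm (k ρ') (p : ℤ)]
  · -- (ii) `v`-unit representatives
    obtain ⟨γ, a, hav, hγ⟩ := exists_repr_not_mem (K := K) h𝔟0 hspan v
    exact ⟨γ, a, hav, hγ⟩

end ClassRadical

/-! ## §2 Joint independence of the class radicals of independent eigenclasses -/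

section Independence

variable {K : Type} [Field K] [NumberField K] {p : ℕ} [hp : Fact p.Prime]

/-- **JOINT INDEPENDENCE OF CLASS RADICALS MODULO `E_K · K^{×p}`.** `p ∤ [K:ℚ]`; a finite family of radicals `α_i ∈ 𝓞 K` with
ideal `p`-th roots `(α_i) = 𝔟_i^p`, `[𝔟_i] = x_i^{[K:ℚ]}`, the classes `x_i` being `𝔽_p`-INDEPENDENT
(`∏ x_i^{n_i} = 1 ⟹ ∀ i, p ∣ n_i`). If `∏ α_i^{n_i} = u · y^p` with `u ∈ E_K` and `y ∈ K`, then `p ∣ n_i` for every `i`.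
Proof: `y = n/d` with `n, d ∈ 𝓞 K`; `(∏ 𝔟_i^{n_i} · (d))^p = (∏ α_i^{n_i} d^p) = (u n^p) = (n)^p`, so `∏ 𝔟_i^{n_i} · (d) = (n)`
(`ideal_pow_left_injective`), hence `∏ x_i^{[K:ℚ] n_i} = 1` in `Cl(𝓞 K)`, and `p ∣ [K:ℚ] n_i`, `p ∤ [K:ℚ]`. (The case of one
class is (iii) of `exists_eigenRadical_of_eigenclass`.) [cite: Washington1997, §10.2 (proof of Thm. 10.9)]
[cite: Gras2003, Ch. II §5.4] -/
theorem forall_dvd_of_prod_pow_eq_unit_mul_pow {ι : Type} [Fintype ι] (hpK : ¬ p ∣ Module.finrank ℚ K)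
    (α : ι → 𝓞 K) (𝔟 : ι → (Ideal (𝓞 K))⁰) (hspan : ∀ i, Ideal.span {α i} = (𝔟 i : Ideal (𝓞 K)) ^ p)
    (x : ι → ClassGroup (𝓞 K)) (hclass : ∀ i, ClassGroup.mk0 (𝔟 i) = x i ^ Module.finrank ℚ K)
    (hind : ∀ n : ι → ℕ, ∏ i, x i ^ n i = 1 → ∀ i, p ∣ n i)
    (u : (𝓞 K)ˣ) (y : K) (n : ι → ℕ) (h : ∏ i, ((α i : 𝓞 K) : K) ^ n i = ((u : 𝓞 K) : K) * y ^ p) :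
    ∀ i, p ∣ n i := by
  classical
  have hpr : p.Prime := hp.out
  have hα0 : ∀ i, α i ≠ 0 := fun i h0 => by
    have h1 := hspan i
    rw [h0, Ideal.span_singleton_eq_bot.mpr rfl] at h1
    exact pow_ne_zero _ (nonZeroDivisors.ne_zero (𝔟 i).2) h1.symm
  -- `y = n / d`
  obtain ⟨nn, d, hd, hnd⟩ := IsFractionRing.div_surjective (A := 𝓞 K) y
  have hd0 : (d : 𝓞 K) ≠ 0 := nonZeroDivisors.ne_zero hd
  have hdK : ((d : 𝓞 K) : K) ≠ 0 := RingOfIntegers.coe_ne_zero_iff.mpr hd0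
  have hrelK : (∏ i, ((α i : 𝓞 K) : K) ^ n i) * ((d : 𝓞 K) : K) ^ p = ((u : 𝓞 K) : K) * ((nn : 𝓞 K) : K) ^ p := by
    rw [h, mul_assoc, ← mul_pow, ← hnd,
      show algebraMap (𝓞 K) K nn / algebraMap (𝓞 K) K d * ((d : 𝓞 K) : K) = ((nn : 𝓞 K) : K) from
        div_mul_cancel₀ _ hdK]
  have hrel : (∏ i, α i ^ n i) * d ^ p = (u : 𝓞 K) * nn ^ p := by
    apply RingOfIntegers.coe_injective; push_cast; exact hrelK
  have hn0 : nn ≠ 0 := by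
    intro h0
    rw [h0, zero_pow hpr.ne_zero, mul_zero, mul_eq_zero] at hrel
    exact hrel.elim (fun h1 => (Finset.prod_ne_zero_iff.mpr fun i _ => pow_ne_zero _ (hα0 i)) h1)
      (fun h1 => hd0 ((pow_eq_zero_iff hpr.ne_zero).mp h1))
  -- the ideal `∏ 𝔟_i^{n_i}` as a nonzero ideal
  set B : (Ideal (𝓞 K))⁰ := ∏ i, 𝔟 i ^ n i with hBdef
  have hBcoe : ((B : (Ideal (𝓞 K))⁰) : Ideal (𝓞 K)) = ∏ i, ((𝔟 i : (Ideal (𝓞 K))⁰) : Ideal (𝓞 K)) ^ n i := by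
    rw [hBdef, Submonoid.coe_finsetProd]
    refine Finset.prod_congr rfl fun i _ => ?_
    rw [SubmonoidClass.coe_pow]
  have hdmem : Ideal.span {(d : 𝓞 K)} ∈ (Ideal (𝓞 K))⁰ := by
    rw [mem_nonZeroDivisors_iff_ne_zero, Ne, Ideal.zero_eq_bot, Ideal.span_singleton_eq_bot]; exact hd0
  -- `(B (d))^p = (n)^p`, so `B (d) = (n)`
  have hideal : ((B : Ideal (𝓞 K)) * Ideal.span {(d : 𝓞 K)}) ^ p = (Ideal.span {nn}) ^ p := by
    rw [mul_pow, hBcoe, ← Finset.prod_pow, Ideal.span_singleton_pow, Ideal.span_singleton_pow]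
    have h1 : ∏ i, (((𝔟 i : (Ideal (𝓞 K))⁰) : Ideal (𝓞 K)) ^ n i) ^ p = Ideal.span {∏ i, α i ^ n i} := by
      rw [← Ideal.prod_span_singleton]
      refine Finset.prod_congr rfl fun i _ => ?_
      rw [← pow_mul, mul_comm, pow_mul, ← hspan i, Ideal.span_singleton_pow]
    rw [h1, Ideal.span_singleton_mul_span_singleton, hrel, Ideal.span_singleton_mul_left_unit u.isUnit]
  have heq : (B : Ideal (𝓞 K)) * Ideal.span {(d : 𝓞 K)} = Ideal.span {nn} := ideal_pow_left_injective hpr.ne_zero hideal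
  -- classes: `mk0 B = 1`
  have h1 : ClassGroup.mk0 B = (ClassGroup.mk0 ⟨Ideal.span {(d : 𝓞 K)}, hdmem⟩)⁻¹ :=
    ClassGroup.mk0_eq_mk0_inv_iff.mpr ⟨nn, hn0, heq⟩
  have h2 : ClassGroup.mk0 ⟨Ideal.span {(d : 𝓞 K)}, hdmem⟩ = 1 :=
    (ClassGroup.mk0_eq_one_iff hdmem).mpr ⟨⟨d, rfl⟩⟩
  rw [h2, inv_one, hBdef, map_prod] at h1
  simp_rw [map_pow, hclass, ← pow_mul] at h1
  -- independence with exponents `[K:ℚ] · n_i`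
  intro i
  have h3 := hind (fun i => Module.finrank ℚ K * n i) h1 i
  exact (Nat.Coprime.dvd_mul_left ((Nat.Prime.coprime_iff_not_dvd hpr).2 hpK)).mp h3

end Independence

end Summit.BirchSwinnertonDyer.BirchSwinnertonDyer.Theorems.PrintCFram.KummerRadical

end
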